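import Mathlib.Analysis.SpecialFunctions.Integrals.Basic
import Mathlib.Analysis.SpecialFunctions.Trigonometric.DerivHyp
import Mathlib.Analysis.Calculus.Deriv.MeanValue
import Mathlib.MeasureTheory.Integral.IntervalIntegral.Basic
import Mathlib.MeasureTheory.Integral.IntervalIntegral.FundThmCalculus

/-!
# Second-order cell quadrature rules for `∫ exp ∘ G` with a tangent-majorised exponent
(crux `WeilComb.CombShapePositivity`, item stmt-RiemannHypothesis-11229, line `Sketch`, brick B0b of the
interval certificate for the diagonal constant of the fixed bump: the two analytic cell rules)

Let `G : ℝ → ℝ` be continuous on a cell `[a, b]` and "concave in tangent form": there is a function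
`G'` (no differentiability is assumed) with `G y ≤ G x + G' x · (y − x)` for all `x, y ∈ [a, b]`.

* `stub_cell_lower_of_tangent` — the chord of `G` lies below `G` (`chord_le_of_tangent`), hence
  `∫_a^b e^{G} ≥ ∫_a^b e^{chord} = (b − a)(e^{G b} − e^{G a})/(G b − G a)` (for `G a ≠ G b`;
  a "logarithmic-mean rule").
* `stub_cell_upper_of_tangent` — the tangent at the midpoint `c = (a+b)/2` lies above `G`, hence with
  `d = G' c`, `y = d(b − a)/2`: `∫_a^b e^{G} ≤ e^{G c} ∫_a^b e^{d(x − c)} dx = (b − a) e^{G c} sinh(y)/y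
  ≤ (b − a) e^{G c} (2 + cosh y)/3` (the last step, `three_mul_sinh_le`, is Simpson's rule being an upper
  bound for the exponential; proved by three successive monotonicity arguments).

Both rules are second-order accurate in the cell width. Only Mathlib is used.
-/

noncomputable section

-- the sub-problem path `RiemannHypothesis/RiemannHypothesis` (single-conjunct summit, D-0017) duplicates a namespace
set_option linter.dupNamespace false

open Real MeasureTheory Set intervalIntegral

namespace Summit.RiemannHypothesis.RiemannHypothesis.Theorems.WeilCombBohrFejer

/-! ## The elementary inequality `3 sinh y ≤ y (2 + cosh y)` for `y ≥ 0` -/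

/-- Monotonicity template: a function vanishing at `0` with a derivative that is nonnegative on
`(0, ∞)` is nonnegative on `[0, ∞)`. [folklore] -/
private theorem nonneg_of_hasDerivAt_nonneg_c4 {φ φ' : ℝ → ℝ} (hφ : ∀ x, HasDerivAt φ (φ' x) x)
    (h0 : φ 0 = 0) (hpos : ∀ x, 0 < x → 0 ≤ φ' x) {y : ℝ} (hy : 0 ≤ y) : 0 ≤ φ y := by
  have hmono : MonotoneOn φ (Ici 0) :=
    monotoneOn_of_hasDerivWithinAt_nonneg (convex_Ici 0)
      (fun x _ => (hφ x).continuousAt.continuousWithinAt)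
      (fun x _ => (hφ x).hasDerivWithinAt)
      (fun x hx => hpos x (by simpa only [interior_Ici, mem_Ioi] using hx))
  have h := hmono (self_mem_Ici (a := (0 : ℝ))) (mem_Ici.2 hy) hy
  rwa [h0] at h

/-- `0 ≤ y cosh y − sinh y` for `y ≥ 0` (derivative `y sinh y ≥ 0`). [folklore] -/
theorem mul_cosh_sub_sinh_nonneg {y : ℝ} (hy : 0 ≤ y) : 0 ≤ y * Real.cosh y - Real.sinh y := by
  refine nonneg_of_hasDerivAt_nonneg_c4 (φ := fun y => y * Real.cosh y - Real.sinh y)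
    (φ' := fun x => x * Real.sinh x) ?_ (by simp) ?_ hy
  · intro x
    have h1 : HasDerivAt (fun y : ℝ => y * Real.cosh y) (1 * Real.cosh x + x * Real.sinh x) x :=
      (hasDerivAt_id x).mul (Real.hasDerivAt_cosh x)
    exact (h1.sub (Real.hasDerivAt_sinh x)).congr_deriv (by ring)
  · intro x hx
    exact mul_nonneg hx.le (Real.sinh_nonneg_iff.2 hx.le)

/-- `0 ≤ 2 − 2 cosh y + y sinh y` for `y ≥ 0` (derivative `y cosh y − sinh y ≥ 0`). [folklore] -/
theorem two_sub_two_mul_cosh_add_mul_sinh_nonneg {y : ℝ} (hy : 0 ≤ y) :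
    0 ≤ 2 - 2 * Real.cosh y + y * Real.sinh y := by
  refine nonneg_of_hasDerivAt_nonneg_c4 (φ := fun y => 2 - 2 * Real.cosh y + y * Real.sinh y)
    (φ' := fun x => x * Real.cosh x - Real.sinh x) ?_
    (by simp) (fun x hx => mul_cosh_sub_sinh_nonneg hx.le) hy
  intro x
  have h1 : HasDerivAt (fun y : ℝ => y * Real.sinh y) (1 * Real.sinh x + x * Real.cosh x) x :=
    (hasDerivAt_id x).mul (Real.hasDerivAt_sinh x)
  have h2 : HasDerivAt (fun y : ℝ => 2 - 2 * Real.cosh y) (-(2 * Real.sinh x)) x :=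
    ((Real.hasDerivAt_cosh x).const_mul 2).const_sub 2
  exact (h2.add h1).congr_deriv (by ring)

/-- **Simpson majorises the exponential.** `3 sinh y ≤ y (2 + cosh y)` for `y ≥ 0`, i.e.
`sinh y / y ≤ (2 + cosh y)/3 = (e^{-y} + 4 + e^{y})/6` (derivative `2 − 2cosh y + y sinh y ≥ 0`). [folklore] -/
theorem three_mul_sinh_le {y : ℝ} (hy : 0 ≤ y) : 3 * Real.sinh y ≤ y * (2 + Real.cosh y) := by
  rw [← sub_nonneg]
  refine nonneg_of_hasDerivAt_nonneg_c4 (φ := fun y => y * (2 + Real.cosh y) - 3 * Real.sinh y)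
    (φ' := fun x => 2 - 2 * Real.cosh x + x * Real.sinh x) ?_
    (by simp) (fun x hx => two_sub_two_mul_cosh_add_mul_sinh_nonneg hx.le) hy
  intro x
  have h1 : HasDerivAt (fun y : ℝ => y * (2 + Real.cosh y))
      (1 * (2 + Real.cosh x) + x * Real.sinh x) x :=
    (hasDerivAt_id x).mul ((Real.hasDerivAt_cosh x).const_add 2)
  have h2 : HasDerivAt (fun y : ℝ => 3 * Real.sinh y) (3 * Real.cosh x) x :=
    (Real.hasDerivAt_sinh x).const_mul 3
  exact (h1.sub h2).congr_deriv (by ring)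

/-! ## Closed-form exponential integrals over a cell -/

/-- `∫_a^b e^{p + q x} dx = (e^{p + q b} − e^{p + q a})/q` for `q ≠ 0`. [folklore] -/
theorem integral_exp_const_add_mul {p q : ℝ} (hq : q ≠ 0) (a b : ℝ) :
    ∫ x in a..b, Real.exp (p + q * x) = (Real.exp (p + q * b) - Real.exp (p + q * a)) / q := by
  rw [intervalIntegral.integral_comp_add_mul Real.exp hq p, integral_exp, smul_eq_mul,
    inv_mul_eq_div]

/-- The centred exponential cell integral against Simpson's value: for `d ≠ 0`, `0 ≤ h`,
`(e^{γ + dh} − e^{γ − dh})/d ≤ 2h · e^{γ} · (2 + cosh(dh))/3`. [folklore] -/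
theorem exp_div_sub_exp_div_le {d : ℝ} (hd : d ≠ 0) (γ : ℝ) {h : ℝ} (hh : 0 ≤ h) :
    Real.exp (γ + d * h) / d - Real.exp (γ - d * h) / d ≤
      2 * h * Real.exp γ * ((2 + Real.cosh (d * h)) / 3) := by
  have hE := Real.exp_pos γ
  have hS : Real.exp (γ + d * h) - Real.exp (γ - d * h) = 2 * Real.exp γ * Real.sinh (d * h) := by
    rw [Real.sinh_eq, Real.exp_add, Real.exp_sub, Real.exp_neg]
    field_simp
  rw [div_sub_div_same, hS]
  rcases lt_or_gt_of_ne hd with hneg | hpos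
  · rw [div_le_iff_of_neg hneg]
    have hy : 0 ≤ -(d * h) := by nlinarith
    have key := three_mul_sinh_le hy
    rw [Real.sinh_neg, Real.cosh_neg] at key
    have := mul_le_mul_of_nonneg_left key hE.le
    linarith
  · rw [div_le_iff₀ hpos]
    have hy : 0 ≤ d * h := by positivity
    have key := three_mul_sinh_le hy
    have := mul_le_mul_of_nonneg_left key hE.le
    linarith

/-- **Tangent-exponential cell integral.** For `a < b` and any `γ, d`:
`∫_a^b e^{γ + d(x − (a+b)/2)} dx ≤ (b − a) e^{γ} (2 + cosh(d(b − a)/2))/3`. [folklore] -/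
theorem integral_exp_tangent_le (γ d : ℝ) {a b : ℝ} (hab : a < b) :
    ∫ x in a..b, Real.exp (γ + d * (x - (a + b) / 2)) ≤
      (b - a) * Real.exp γ * ((2 + Real.cosh (d * (b - a) / 2)) / 3) := by
  rcases eq_or_ne d 0 with hd0 | hd0
  · subst hd0
    simp only [zero_mul, add_zero, zero_div, Real.cosh_zero, intervalIntegral.integral_const,
      smul_eq_mul]
    norm_num
  · have hderiv : ∀ x ∈ uIcc a b, HasDerivAt (fun x => Real.exp (γ + d * (x - (a + b) / 2)) / d)
        (Real.exp (γ + d * (x - (a + b) / 2))) x := by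
      intro x _
      have h1 : HasDerivAt (fun x => γ + d * (x - (a + b) / 2)) (d * 1) x :=
        (((hasDerivAt_id x).sub_const ((a + b) / 2)).const_mul d).const_add γ
      have h2 : HasDerivAt (fun x => Real.exp (γ + d * (x - (a + b) / 2)))
          (Real.exp (γ + d * (x - (a + b) / 2)) * d) x := by
        simpa only [mul_one] using h1.exp
      have h3 := h2.div_const d
      rwa [mul_div_cancel_right₀ _ hd0] at h3
    rw [intervalIntegral.integral_eq_sub_of_hasDerivAt hderiv
      ((by fun_prop : Continuous fun x => Real.exp (γ + d * (x - (a + b) / 2))).intervalIntegrable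
        (μ := volume) a b)]
    have e1 : γ + d * (b - (a + b) / 2) = γ + d * ((b - a) / 2) := by ring
    have e2 : γ + d * (a - (a + b) / 2) = γ - d * ((b - a) / 2) := by ring
    have e3 : d * (b - a) / 2 = d * ((b - a) / 2) := by ring
    have e4 : (b - a) * Real.exp γ = 2 * ((b - a) / 2) * Real.exp γ := by ring
    rw [e1, e2, e3, e4]
    exact exp_div_sub_exp_div_le hd0 γ (by linarith)

/-! ## The chord of a tangent-majorised function -/

/-- If `G y ≤ G x + G' x (y − x)` on `[a, b]` then the chord lies below `G`:
`(b − x) G a + (x − a) G b ≤ (b − a) G x` for `x ∈ [a, b]`. [folklore] -/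
theorem chord_le_of_tangent {G G' : ℝ → ℝ} {a b x : ℝ}
    (htan : ∀ x ∈ Icc a b, ∀ y ∈ Icc a b, G y ≤ G x + G' x * (y - x)) (hx : x ∈ Icc a b) :
    (b - x) * G a + (x - a) * G b ≤ (b - a) * G x := by
  have hab : a ≤ b := hx.1.trans hx.2
  have h1 := htan x hx a (left_mem_Icc.2 hab)
  have h2 := htan x hx b (right_mem_Icc.2 hab)
  have hbx : 0 ≤ b - x := sub_nonneg.2 hx.2
  have hxa : 0 ≤ x - a := sub_nonneg.2 hx.1
  have h3 := add_le_add (mul_le_mul_of_nonneg_left h1 hbx) (mul_le_mul_of_nonneg_left h2 hxa)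
  have e : (b - x) * (G x + G' x * (a - x)) + (x - a) * (G x + G' x * (b - x)) = (b - a) * G x := by
    ring
  linarith

/-! ## The two cell rules -/

/-- **Cell lower rule (logarithmic-mean rule).** If `G` is continuous on `[a, b]`, concave in tangent
form there, and `G a ≠ G b`, then `(b − a)(e^{G b} − e^{G a})/(G b − G a) ≤ ∫_a^b e^{G}`
(the left side is the integral of the exponential of the chord). [folklore] -/
theorem stub_cell_lower_of_tangent : ∀ (G G' : ℝ → ℝ) (a b : ℝ), a < b →
    ContinuousOn G (Set.Icc a b) →
    (∀ x ∈ Set.Icc a b, ∀ y ∈ Set.Icc a b, G y ≤ G x + G' x * (y - x)) → G a ≠ G b →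
    (b - a) * (Real.exp (G b) - Real.exp (G a)) / (G b - G a) ≤ ∫ x in a..b, Real.exp (G x) := by
  intro G G' a b hab hG htan hne
  have hba : 0 < b - a := sub_pos.2 hab
  have hGba : G b - G a ≠ 0 := sub_ne_zero.2 hne.symm
  obtain ⟨σ, hσ⟩ : ∃ σ : ℝ, σ = (G b - G a) / (b - a) := ⟨_, rfl⟩
  have hσ0 : σ ≠ 0 := by rw [hσ]; exact div_ne_zero hGba hba.ne'
  -- pointwise: the exponential of the chord is a minorant
  have hpt : ∀ x ∈ Icc a b, Real.exp ((G a - σ * a) + σ * x) ≤ Real.exp (G x) := by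
    intro x hx
    apply Real.exp_le_exp.2
    have hch := chord_le_of_tangent htan hx
    have e : G a - σ * a + σ * x = ((b - x) * G a + (x - a) * G b) / (b - a) := by
      rw [hσ]; field_simp; ring
    rw [e, div_le_iff₀ hba]
    linarith
  have hint := intervalIntegral.integral_mono_on hab.le
    ((by fun_prop : Continuous fun x => Real.exp ((G a - σ * a) + σ * x)).intervalIntegrable
      (μ := volume) a b)
    (ContinuousOn.intervalIntegrable_of_Icc hab.le hG.rexp) hpt
  rw [integral_exp_const_add_mul hσ0] at hint
  have e1 : G a - σ * a + σ * b = G b := by rw [hσ]; field_simp; ring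
  have e2 : G a - σ * a + σ * a = G a := by ring
  rw [e1, e2, hσ, div_div_eq_mul_div] at hint
  calc (b - a) * (Real.exp (G b) - Real.exp (G a)) / (G b - G a)
      = (Real.exp (G b) - Real.exp (G a)) * (b - a) / (G b - G a) := by ring
    _ ≤ ∫ x in a..b, Real.exp (G x) := hint

/-- **Cell upper rule (midpoint tangent + Simpson).** If `G` is continuous on `[a, b]` and concave in
tangent form there, then with `c = (a+b)/2`:
`∫_a^b e^{G} ≤ (b − a) e^{G c} (2 + cosh(G' c (b − a)/2))/3`. [folklore] -/
theorem stub_cell_upper_of_tangent : ∀ (G G' : ℝ → ℝ) (a b : ℝ), a < b →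
    ContinuousOn G (Set.Icc a b) →
    (∀ x ∈ Set.Icc a b, ∀ y ∈ Set.Icc a b, G y ≤ G x + G' x * (y - x)) →
    ∫ x in a..b, Real.exp (G x) ≤
      (b - a) * Real.exp (G ((a + b) / 2)) * ((2 + Real.cosh (G' ((a + b) / 2) * (b - a) / 2)) / 3) := by
  intro G G' a b hab hG htan
  have hc : (a + b) / 2 ∈ Icc a b := ⟨by linarith, by linarith⟩
  -- pointwise: the exponential of the midpoint tangent is a majorant
  have hpt : ∀ x ∈ Icc a b, Real.exp (G x) ≤
      Real.exp (G ((a + b) / 2) + G' ((a + b) / 2) * (x - (a + b) / 2)) :=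
    fun x hx => Real.exp_le_exp.2 (htan _ hc x hx)
  have hint := intervalIntegral.integral_mono_on hab.le
    (ContinuousOn.intervalIntegrable_of_Icc hab.le hG.rexp)
    ((by fun_prop : Continuous fun x =>
      Real.exp (G ((a + b) / 2) + G' ((a + b) / 2) * (x - (a + b) / 2))).intervalIntegrable
        (μ := volume) a b) hpt
  exact hint.trans (integral_exp_tangent_le _ _ hab)

end Summit.RiemannHypothesis.RiemannHypothesis.Theorems.WeilCombBohrFejer

end
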